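import Mathlib
import HarnessLib
import Literature.MathematicalPhysics.StatisticalMechanics.RenormalisationMapRemaindersOneQ
import Literature.MathematicalPhysics.StatisticalMechanics.RenormalisationMapBlockBracketKernelOnly
import Literature.MathematicalPhysics.StatisticalMechanics.StepOperatorBKernelSubScale

/-!
# The block sum `Σ₁` of `S_k` for TWO STEP KERNELS at a FIXED extracted Hamiltonian: the kernel-only piece
# ([ABKM19] Theorem 6.8 (6.59)–(6.60) ⊗ Lemma 8.4; hypothesis (12.53) of Lemma 12.6)

In the decomposition `S_k(H,K)(U) = blockPart + Σ₁ + Σ₂ᴸ + Σ₃ + Σ₄` ([ABKM19] (6.59)–(6.60),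
`nextKStep_eq_blockPart_add_remainders_abkm_of_stepKernelBounds`) the block sum is
`Σ₁ = Σ_B [(p_B(H̃) − 1)·G_𝒞(B) + p_B(H̃)·Φ_B(𝒞, H, B_𝒞K) + p_B(H̃)·R_𝒞[rest(B)]]` (`rest(B) = 0` on blocks).  Its
one-kernel Lipschitz bound `tayNormLE_remainderOne_sub_abkm_of_stepKernelBounds` compares `(H̃, H, K)` with `(H̃', H', K')`
at ONE kernel.  For the volume-uniform two-kernel comparison of `S_k` (child `TwoKernelSkBound` of the cruxes
`HypACumulant` / `HypALocalTwoPoint` of the route `Summits/HubbardSuperconductivity/…/Theses/ComplexGFFStiffness`, line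
`banach_two_kernel`) one splits `ΔΣ₁ = [Σ₁(D_a; H̃_a) − Σ₁(D_a; H̃_b)] + [Σ₁(D_a; H̃_b) − Σ₁(D_b; H̃_b)]`; the first bracket
is the landed one-kernel theorem (`H' = H`, `K' = K`), the second — SAME `(H̃, H, K)`, two step data `D_a, D_b` sharing
`s, L, B₀, c₀` — is this file:

* `tayNormLE_blockTerm_kernelOnly_sub_abkm_of_stepKernelBounds` — `|G_a(B) − G_b(B)|_{T_k^{B*}, w_{k:k+1}^B} ≤
  (1 + 8C_{8.7})·(C ℓ κ_p A^{−1})` (pair property on the block + `StepOperatorBKernelSubScale`);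
* **`tayNormLE_remainderOne_kernelOnly_sub_abkm_of_stepKernelBounds`** — the kernel-only `Σ₁` bound
  `|U|_k κ^{|U|_k}·(16e^{3/8}τ·ρ₁ᴷ + ρ_Φᴷ)`, `ρ₁ᴷ = (1+8C_{8.7})(Cℓκ_pA^{−1})`, `ρ_Φᴷ` the sum of the one-kernel
  bracket bound at `(H, H, B_aK, B_bK)` and the kernel-only bracket bound (`RenormalisationMapBlockBracketKernelOnly`),
  via the two abstract slot lemmas (`tayNormLE_subsum_pMinusOne_sub_abkm_slot`, `tayNormLE_subsum_reblockTerm_sub_abkm_slot`)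
  with `H̃' := H̃`.  Every term carries `ℓ` or `δ_γ` (the kernel-difference sizes) — the shape (12.53) needs.

Everything is proved; no named fact.

## References
* S. Adams, S. Buchholz, R. Kotecký, S. Müller, arXiv:1910.13564, Theorem 6.8 ((6.59)–(6.60)), Ch. 9.1, Lemma 8.4,
  Lemmas 10.1–10.6, Lemma 12.6 (12.53) [AdamsBuchholzKoteckyMuller2019].
-/

noncomputable section

namespace Literature.MathematicalPhysics.StatisticalMechanics.GradientRG

open scoped BigOperators Classical
open Finset Matrix MeasureTheory
open Literature.MathematicalPhysics.StatisticalMechanics.TorusPolymer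
  (IsPolymer blocks polys bprod blockOf thicken reblock boxCorner mem_polys mem_blocks numBlocks isPolymer_blockOf
    card_blocks_eq_numBlocks blocks_blockOf empty_mem_polys reblock_empty subset_thicken sum_large_regroup
    bprod_empty blocks_empty blocks_mono add_pow_sub_pow_le sum_rest_blockOf_eq_zero closure card_blockOf)
open Literature.Barriers.CriticalPhenomena.LongRangePhi4.Polymer (IsConn components)
open Literature.MathematicalPhysics.StatisticalMechanics.GradientFRD (iterDiff)
open Literature.MathematicalPhysics.QuantumFieldTheory

variable {d M : ℕ} [NeZero M]

/-- **Kernel-only bound of `blockTerm` in the slot norm**: torus data at scale `k` (`d ≥ 3`, `L` odd,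
`L ≥ 2^{d+3}+16R`, `M = L^N`, `k+1 ≤ N`, `p + d ≤ M_ord ≤ R`, `r₀ ≥ 3`, `A ≥ 1`), two step data `D, Db` sharing
`B₀ = B_{x₀}` and its box corner with `StepKernelBounds` relative to the `q = 0` weights, the pair property of
Lemma 8.4 on connected `k`-polymers (`‖R_aF − R_bF‖ ≤ b·ℓ·κ_p^{|X|_k}`), `‖K‖_k^{(A)} ≤ C`, `C^{r₀}`, local: on any block
`B = B_x`, `|G_a(B) − G_b(B)|_{T_k^{B*}, w_{k:k+1}^B} ≤ (1 + 8C_{8.7})·(C ℓ κ_p A^{−1})`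
(`G_𝒞(B) = R_𝒞K(B) + (B_𝒞K)(B)`). [cite: AdamsBuchholzKoteckyMuller2019, Ch. 10.1 (10.4) / Lemma 10.6 / Lemma 12.6 (12.52)–(12.53)] -/
theorem tayNormLE_blockTerm_kernelOnly_sub_abkm_of_stepKernelBounds {L N Mord R n p r₀ : ℕ}
    {θbar lam μ δ₁ δ₀ A𝒫 A𝒫a A𝒫b C₂a C₂b h A : ℝ}
    {𝒞 : ℕ → (Fin d → ZMod M) → ℝ} (hd : 3 ≤ d) (hLodd : Odd L) (hL : 2 ^ (d + 3) + 16 * R ≤ L)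
    (hM : M = L ^ N) {k : ℕ} (hkN : k + 1 ≤ N) (hp : d / 2 + 1 ≤ p) (hpM : p + d ≤ Mord) (hMR : Mord ≤ R)
    (hr₀ : 3 ≤ r₀)
    (hB : AbkmWeightBounds L N Mord R n θbar lam μ δ₁ δ₀ A𝒫 𝒞
      (abkmWeightData L N Mord R θbar (schedDelta δ₀ δ₁ N) 𝒞))
    (hδ₀ : 0 < δ₀) (hδ₁ : 0 < δ₁) (hh : 0 < h) (hh0 : hZeroSq d R δ₀ δ₁ ≤ h ^ 2) (hA : 1 ≤ A)
    (D Db : StepData d M)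
    (hS : StepKernelBounds (abkmWeightData L N Mord R θbar (schedDelta δ₀ δ₁ N) 𝒞) L k A𝒫a C₂a D.𝒞)
    (hSb : StepKernelBounds (abkmWeightData L N Mord R θbar (schedDelta δ₀ δ₁ N) 𝒞) L k A𝒫b C₂b Db.𝒞)
    {x₀ : Fin d → ZMod M} (hB₀ : D.B₀ = blockOf (L ^ k) x₀)
    (hc₀ : D.c₀ = boxCorner (L ^ k) (starRad R L d k) x₀) (hDbB : Db.B₀ = D.B₀) (hDbc : Db.c₀ = D.c₀)
    {ℓ κp : ℝ}
    (hdiff : ∀ X : Finset (Fin d → ZMod M), IsPolymer (L ^ k) X → IsConn X →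
      ∀ (F : ((Fin d → ZMod M) → ℝ) → ℂ) (b : ℝ), 0 ≤ b → ContDiff ℝ r₀ F →
        IsGaugeLocal ((abkmNormParams L N Mord R p r₀ h θbar A (schedDelta δ₀ δ₁ N) 𝒞).gauge k X) F →
        TayNormLE ((abkmNormParams L N Mord R p r₀ h θbar A (schedDelta δ₀ δ₁ N) 𝒞).gauge k X) r₀
          ((abkmWeightData L N Mord R θbar (schedDelta δ₀ δ₁ N) 𝒞).weight k X) F b →
          TayNormLE ((abkmNormParams L N Mord R p r₀ h θbar A (schedDelta δ₀ δ₁ N) 𝒞).gauge k X) r₀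
            ((abkmWeightData L N Mord R θbar (schedDelta δ₀ δ₁ N) 𝒞).midWeight k X)
            (fluct D.𝒞 F - fluct Db.𝒞 F) (b * ℓ * κp ^ numBlocks (L ^ k) X))
    (x : Fin d → ZMod M)
    {K : Finset (Fin d → ZMod M) → ((Fin d → ZMod M) → ℝ) → ℂ} {C : ℝ} (hC : 0 ≤ C)
    (hK : WeakNormLE (abkmNormParams L N Mord R p r₀ h θbar A (schedDelta δ₀ δ₁ N) 𝒞) k K C)
    (hKd : ∀ X, ContDiff ℝ r₀ (K X))
    (hKloc : ∀ X, IsPolymer (L ^ k) X → IsConn X →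
      IsGaugeLocal ((abkmNormParams L N Mord R p r₀ h θbar A (schedDelta δ₀ δ₁ N) 𝒞).gauge k X) (K X)) :
    TayNormLE ((abkmNormParams L N Mord R p r₀ h θbar A (schedDelta δ₀ δ₁ N) 𝒞).gauge k (blockOf (L ^ k) x))
      r₀ ((abkmWeightData L N Mord R θbar (schedDelta δ₀ δ₁ N) 𝒞).midWeight k (blockOf (L ^ k) x))
      (fun φ => blockTerm D K (blockOf (L ^ k) x) φ - blockTerm Db K (blockOf (L ^ k) x) φ)
      ((1 + 8 * pi2BoundConst d (((2 * R + 2 : ℕ) : ℝ) + ((d / 2 + 1 : ℕ) : ℝ))) * (C * ℓ * κp * A⁻¹)) := by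
  set P := abkmNormParams L N Mord R p r₀ h θbar A (schedDelta δ₀ δ₁ N) 𝒞 with hP
  set W := abkmWeightData L N Mord R θbar (schedDelta δ₀ δ₁ N) 𝒞 with hW
  set B := blockOf (L ^ k) x with hBdef
  set C87 := pi2BoundConst d (((2 * R + 2 : ℕ) : ℝ) + ((d / 2 + 1 : ℕ) : ℝ)) with hC87
  have hd2 : 2 ≤ d := by omega
  have hMord : d / 2 + 1 ≤ Mord := by omega
  have hL0 : (0 : ℝ) < L := by exact_mod_cast hLodd.pos
  have hA0 : 0 < A := by linarith
  have hk' : k + 1 ≤ N + 1 := by omega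
  have hk : k ≤ N := by omega
  obtain ⟨t, ht⟩ : ∃ t, N = k + t := ⟨N - k, by omega⟩
  have hMt : M = L ^ k * L ^ t := by rw [← pow_add, ← ht]; exact hM
  have hMo : Odd M := by rw [hM]; exact hLodd.pow
  have hcard : B.card = L ^ (d * k) := by
    rw [hBdef, card_blockOf hMt hLodd.pow hLodd.pow x, ← pow_mul, mul_comm]
  have h𝔥 : 0 < fieldWt h (L : ℝ) d k := fieldWt_pos hh hL0 d k
  have hRk : (0 : ℝ) < (L : ℝ) ^ k := by positivity
  have hBS : B ⊆ thicken (P.rad k) B := subset_thicken _ _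
  have hgauge : P.gauge k B = fieldGauge (fieldWt h (L : ℝ) d k) ((L : ℝ) ^ k) p (thicken (P.rad k) B) := rfl
  have hPB : IsPolymer (L ^ k) B := isPolymer_blockOf _ x
  have hcB : IsConn B := TorusPolymer.isConn_blockOf hMo hLodd.pow x
  have hnB : numBlocks (L ^ k) B = 1 := by
    rw [← card_blocks_eq_numBlocks, hBdef, blocks_blockOf, card_singleton]
  have haF : P.aFactor k B = A⁻¹ := by
    show (A ^ numBlocks (L ^ k) B)⁻¹ = A⁻¹; rw [hnB, pow_one]
  have hC87_0 : 0 ≤ C87 := pi2BoundConst_nonneg d (by positivity)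
  -- (i) `(R_a − R_b)K(B)` by the pair property on the block
  have hKB : TayNormLE (P.gauge k B) r₀ (W.weight k B) (K B) (C * A⁻¹) := by
    have h1 := hK B hPB hcB; rw [haF] at h1; exact h1
  have hc1 : 0 ≤ C * A⁻¹ := by positivity
  have hR : TayNormLE (P.gauge k B) r₀ (W.midWeight k B) (fluct D.𝒞 (K B) - fluct Db.𝒞 (K B))
      (C * A⁻¹ * ℓ * κp) := by
    have h1 := hdiff B hPB hcB (K B) _ hc1 (hKd B) (hKloc B hPB hcB) hKB
    rw [hnB, pow_one] at h1
    exact h1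
  have hRd : ContDiff ℝ r₀ (fluct D.𝒞 (K B) - fluct Db.𝒞 (K B)) :=
    (contDiff_fluct_of_weakNormLE_of_stepKernelBounds hB hS hA0 hC hK hKd hKloc hPB hcB).sub
      (contDiff_fluct_of_weakNormLE_of_stepKernelBounds hB hSb hA0 hC hK hKd hKloc hPB hcB)
  -- (ii) `((B_a − B_b)K)(B)` in the strong norm
  have hSW : ∀ φ, expWeight (strongCoef h N k • derivForm (L : ℝ) k (diffIndex d Mord)
      (boxDensity (boxRad R L k) (boxWt (L : ℝ) d k) B)) φ ≤ W.weight k B φ :=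
    fun φ => strongWeight_le_weight_abkm hB hδ₀ hδ₁ hh hh0 k (subset_refl B) φ
  have hwm : ∀ φ, W.weight k B φ ≤ W.midWeight k B φ := fun φ =>
    WeightData.weight_le_midWeight hB.dominated k B φ
  have hev_s := tayNormLE_eval_strong_abkm (R := R) (Mord := Mord) hd2 hLodd hM hk hh hMord hp hBS
    (opB D K - opB Db K) r₀
  rw [← hgauge, hcard] at hev_s
  have hopB := hamNorm_opB_sub_abkm_le_scale_of_stepKernelBounds (p := p) hd hLodd hL hM hkN hpM hMR hr₀ hB hh hA
    D Db hS hSb hB₀ hc₀ hDbB hDbc hdiff hC hK hKd hKloc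
  have hn0 : 0 ≤ hamNorm (fieldWt h (L : ℝ) d k) ((L : ℝ) ^ k) (L ^ (d * k)) (opB D K - opB Db K) :=
    hamNorm_nonneg h𝔥.le hRk.le _ _
  have hc2 : 0 ≤ 8 * hamNorm (fieldWt h (L : ℝ) d k) ((L : ℝ) ^ k) (L ^ (d * k)) (opB D K - opB Db K) := by
    positivity
  have hE : TayNormLE (P.gauge k B) r₀ (W.midWeight k B)
      (fun φ : (Fin d → ZMod M) → ℝ => eval (opB D K - opB Db K) B φ) (8 * (C87 * (C * ℓ * κp * A⁻¹))) :=
    (((hev_s.mono_weight hc2 hSW).mono_weight hc2 hwm).mono (by nlinarith) fun φ => (W.midWeight_pos k B φ).le)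
  -- combine
  have heq : (fun φ => blockTerm D K B φ - blockTerm Db K B φ) =
      (fluct D.𝒞 (K B) - fluct Db.𝒞 (K B)) + fun φ : (Fin d → ZMod M) → ℝ => eval (opB D K - opB Db K) B φ := by
    funext φ
    simp only [blockTerm, Pi.add_apply, Pi.sub_apply, eval_sub]
    ring
  rw [heq]
  refine ((hR.add hE hRd (contDiff_eval _ _)).mono ?_ fun φ => (W.midWeight_pos k B φ).le)
  ring_nf
  rfl

set_option maxHeartbeats 800000 in
/-- **Kernel-only two-kernel bound of `Σ₁`** (module docstring): torus data at scale `k` (`d ≥ 3`, `L` odd,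
`L ≥ 2^{d+3}+16R`, `R ≥ 2`, `M = L^N`, `k+1 ≤ N`, `⌊d/2⌋+1 ≤ p`, `p + d ≤ M_ord ≤ R`, `r₀ ≥ 3`, `h² ≥ h₀²`,
`A ≥ 1`), two step data `D, Db` with `D.s = Db.s = L^k`, `D.L = Db.L = L`, the same reference block `B_{x₀}` and box
corner, `StepKernelBounds` with `C₂ ≤ h²` for both kernels, `L^{dk}|γ_q(D.𝒞) − γ_q(Db.𝒞)| ≤ δ_γ`, the pair property of
Lemma 8.4 on connected `k`-polymers; `U` a `(k+1)`-polymer; ONE extracted Hamiltonian `‖H̃‖ ≤ τ ≤ 1/16` on both sides,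
`‖H‖ ≤ b ≤ 1/64`, `‖K‖ ≤ C`, `C_{8.7}CA_{𝒫,•}A^{−1} ≤ 1/64`, `κ ≥ 1 + e^{1/4} + 16e^{3/8}τ`.  Then
`|Σ₁(D; H̃) − Σ₁(Db; H̃)|_{T_{k+1}^{U*}, w_{k+1}^U} ≤ |U|_k κ^{|U|_k} (16e^{3/8}τ·ρ₁ᴷ + ρ_Φᴷ)` with
`ρ₁ᴷ = (1+8C_{8.7})(Cℓκ_pA^{−1})` and `ρ_Φᴷ` displayed (every term carries `ℓ` or `δ_γ`).
[cite: AdamsBuchholzKoteckyMuller2019, Theorem 6.8 / Lemma 9.6 (proof, first order) / Lemma 12.6 (12.53)] -/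
theorem tayNormLE_remainderOne_kernelOnly_sub_abkm_of_stepKernelBounds {L N Mord R n p r₀ : ℕ}
    {θbar lam μ δ₁ δ₀ A𝒫 A𝒫a A𝒫b C₂a C₂b h A : ℝ}
    {𝒞 : ℕ → (Fin d → ZMod M) → ℝ} (hd : 3 ≤ d) (hLodd : Odd L) (hL : 2 ^ (d + 3) + 16 * R ≤ L)
    (hR2 : 2 ≤ R) (hM : M = L ^ N) {k : ℕ} (hkN : k + 1 ≤ N) (hp : d / 2 + 1 ≤ p) (hpM : p + d ≤ Mord)
    (hMR : Mord ≤ R) (hr₀ : 3 ≤ r₀)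
    (hB : AbkmWeightBounds L N Mord R n θbar lam μ δ₁ δ₀ A𝒫 𝒞
      (abkmWeightData L N Mord R θbar (schedDelta δ₀ δ₁ N) 𝒞))
    (hδ₀ : 0 < δ₀) (hδ₁ : 0 < δ₁) (hh : 0 < h) (hh0 : hZeroSq d R δ₀ δ₁ ≤ h ^ 2)
    (hh2a : C₂a ≤ h ^ 2) (hh2b : C₂b ≤ h ^ 2) (hA𝒫a : 0 ≤ A𝒫a) (hA𝒫b : 0 ≤ A𝒫b) (hA1 : 1 ≤ A)
    (D Db : StepData d M) (hDs : D.s = L ^ k) (hDL : D.L = L)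
    (hS : StepKernelBounds (abkmWeightData L N Mord R θbar (schedDelta δ₀ δ₁ N) 𝒞) L k A𝒫a C₂a D.𝒞)
    (hSb : StepKernelBounds (abkmWeightData L N Mord R θbar (schedDelta δ₀ δ₁ N) 𝒞) L k A𝒫b C₂b Db.𝒞)
    {x₀ : Fin d → ZMod M} (hB₀ : D.B₀ = blockOf (L ^ k) x₀) (hc₀ : D.c₀ = boxCorner (L ^ k) (starRad R L d k) x₀)
    (hDbB : Db.B₀ = D.B₀) (hDbc : Db.c₀ = D.c₀)
    {δγ : ℝ} (hδγ : 0 ≤ δγ)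
    (hγab : ∀ q, ((L ^ (d * k) : ℕ) : ℝ) * |gradCov D.𝒞 q - gradCov Db.𝒞 q| ≤ δγ)
    {ℓ κp : ℝ} (hℓ : 0 ≤ ℓ) (hκp : 0 ≤ κp)
    (hdiff : ∀ X : Finset (Fin d → ZMod M), IsPolymer (L ^ k) X → IsConn X →
      ∀ (F : ((Fin d → ZMod M) → ℝ) → ℂ) (b : ℝ), 0 ≤ b → ContDiff ℝ r₀ F →
        IsGaugeLocal ((abkmNormParams L N Mord R p r₀ h θbar A (schedDelta δ₀ δ₁ N) 𝒞).gauge k X) F →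
        TayNormLE ((abkmNormParams L N Mord R p r₀ h θbar A (schedDelta δ₀ δ₁ N) 𝒞).gauge k X) r₀
          ((abkmWeightData L N Mord R θbar (schedDelta δ₀ δ₁ N) 𝒞).weight k X) F b →
          TayNormLE ((abkmNormParams L N Mord R p r₀ h θbar A (schedDelta δ₀ δ₁ N) 𝒞).gauge k X) r₀
            ((abkmWeightData L N Mord R θbar (schedDelta δ₀ δ₁ N) 𝒞).midWeight k X)
            (fluct D.𝒞 F - fluct Db.𝒞 F) (b * ℓ * κp ^ numBlocks (L ^ k) X))
    {U : Finset (Fin d → ZMod M)} (hU : IsPolymer (L ^ (k + 1)) U)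
    {Ht H : RelevantHamiltonian ℂ d} {τ b : ℝ}
    (hHt : hamNorm (fieldWt h (L : ℝ) d k) ((L : ℝ) ^ k) (L ^ (d * k)) Ht ≤ τ) (hτ : τ ≤ 1 / 16)
    (hH : hamNorm (fieldWt h (L : ℝ) d k) ((L : ℝ) ^ k) (L ^ (d * k)) H ≤ b) (hb : b ≤ 1 / 64)
    {K : Finset (Fin d → ZMod M) → ((Fin d → ZMod M) → ℝ) → ℂ} {C : ℝ} (hC : 0 ≤ C)
    (hK : WeakNormLE (abkmNormParams L N Mord R p r₀ h θbar A (schedDelta δ₀ δ₁ N) 𝒞) k K C)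
    (hKd : ∀ Y, ContDiff ℝ r₀ (K Y))
    (hKloc : ∀ Y, IsPolymer (L ^ k) Y → IsConn Y →
      IsGaugeLocal ((abkmNormParams L N Mord R p r₀ h θbar A (schedDelta δ₀ δ₁ N) 𝒞).gauge k Y) (K Y))
    (hva : pi2BoundConst d (((2 * R + 2 : ℕ) : ℝ) + ((d / 2 + 1 : ℕ) : ℝ)) * (C * A𝒫a * A⁻¹) ≤ 1 / 64)
    (hvb : pi2BoundConst d (((2 * R + 2 : ℕ) : ℝ) + ((d / 2 + 1 : ℕ) : ℝ)) * (C * A𝒫b * A⁻¹) ≤ 1 / 64)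
    {κ : ℝ} (hκ' : 1 + Real.exp (1 / 4) + 16 * Real.exp (3 / 8) * τ ≤ κ) :
    TayNormLE ((abkmNormParams L N Mord R p r₀ h θbar A (schedDelta δ₀ δ₁ N) 𝒞).gauge (k + 1) U) r₀
      ((abkmWeightData L N Mord R θbar (schedDelta δ₀ δ₁ N) 𝒞).weight (k + 1) U)
      (fun φ => (∑ B ∈ blockPartIndex D U,
        ((bprod (L ^ k) (fun B' => expNegH Ht B' φ) (U \ B) *
              bprod (L ^ k) (fun B' => expNegH (-Ht) B' φ) (B \ U) - 1) * blockTerm D K B φ +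
          bprod (L ^ k) (fun B' => expNegH Ht B' φ) (U \ B) *
              bprod (L ^ k) (fun B' => expNegH (-Ht) B' φ) (B \ U) *
            (fluctDefect D.𝒞 H B φ +
              (expNegH (stepOpA (gradCov D.𝒞) H) B φ - 1) * (1 - Complex.exp (-(eval (opB D K) B φ))) -
              (Complex.exp (-(eval (opB D K) B φ)) - 1 + eval (opB D K) B φ)) +
          bprod (L ^ k) (fun B' => expNegH Ht B' φ) (U \ B) *
              bprod (L ^ k) (fun B' => expNegH (-Ht) B' φ) (B \ U) *
            fluct D.𝒞 (fun ψ => ∑ Y ∈ ((polys (L ^ k) B).erase B).erase ∅,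
              bprod (L ^ k) (fun B' => expNegH H B' ψ - 1) (B \ Y) * K Y ψ) φ)) -
        (∑ B ∈ blockPartIndex D U,
        ((bprod (L ^ k) (fun B' => expNegH Ht B' φ) (U \ B) *
              bprod (L ^ k) (fun B' => expNegH (-Ht) B' φ) (B \ U) - 1) * blockTerm Db K B φ +
          bprod (L ^ k) (fun B' => expNegH Ht B' φ) (U \ B) *
              bprod (L ^ k) (fun B' => expNegH (-Ht) B' φ) (B \ U) *
            (fluctDefect Db.𝒞 H B φ +
              (expNegH (stepOpA (gradCov Db.𝒞) H) B φ - 1) * (1 - Complex.exp (-(eval (opB Db K) B φ))) -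
              (Complex.exp (-(eval (opB Db K) B φ)) - 1 + eval (opB Db K) B φ)) +
          bprod (L ^ k) (fun B' => expNegH Ht B' φ) (U \ B) *
              bprod (L ^ k) (fun B' => expNegH (-Ht) B' φ) (B \ U) *
            fluct Db.𝒞 (fun ψ => ∑ Y ∈ ((polys (L ^ k) B).erase B).erase ∅,
              bprod (L ^ k) (fun B' => expNegH H B' ψ - 1) (B \ Y) * K Y ψ) φ)))
      ((blocks (L ^ k) U).card * κ ^ (blocks (L ^ k) U).card *
        (16 * Real.exp (3 / 8) * τ *
            ((1 + 8 * pi2BoundConst d (((2 * R + 2 : ℕ) : ℝ) + ((d / 2 + 1 : ℕ) : ℝ))) * (C * ℓ * κp * A⁻¹)) +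
          (512 * Real.exp (1 / 4) *
              (b * (pi2BoundConst d (((2 * R + 2 : ℕ) : ℝ) + ((d / 2 + 1 : ℕ) : ℝ)) * (C * ℓ * κp * A⁻¹))) +
            256 * Real.exp (1 / 4) *
              (pi2BoundConst d (((2 * R + 2 : ℕ) : ℝ) + ((d / 2 + 1 : ℕ) : ℝ)) * (C * A𝒫b * A⁻¹) +
                pi2BoundConst d (((2 * R + 2 : ℕ) : ℝ) + ((d / 2 + 1 : ℕ) : ℝ)) * (C * ℓ * κp * A⁻¹)) *
              (pi2BoundConst d (((2 * R + 2 : ℕ) : ℝ) + ((d / 2 + 1 : ℕ) : ℝ)) * (C * ℓ * κp * A⁻¹)) +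
            (8 * Real.exp (1 / 4) * b * ℓ * κp + 16 * Real.exp (3 / 8) * (δγ / h ^ 2 * b) +
              256 * Real.exp (1 / 4) * (2 * (δγ / h ^ 2 * b)) *
                (pi2BoundConst d (((2 * R + 2 : ℕ) : ℝ) + ((d / 2 + 1 : ℕ) : ℝ)) * (C * A𝒫b * A⁻¹)))))) := by
  set P := abkmNormParams L N Mord R p r₀ h θbar A (schedDelta δ₀ δ₁ N) 𝒞 with hP
  set W := abkmWeightData L N Mord R θbar (schedDelta δ₀ δ₁ N) 𝒞 with hW
  set C87 := pi2BoundConst d (((2 * R + 2 : ℕ) : ℝ) + ((d / 2 + 1 : ℕ) : ℝ)) with hC87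
  set va := C87 * (C * A𝒫a * A⁻¹) with hvadef
  set vb := C87 * (C * A𝒫b * A⁻¹) with hvbdef
  set vK := C87 * (C * ℓ * κp * A⁻¹) with hvKdef
  set Δt := 16 * Real.exp (3 / 8) * hamNorm (fieldWt h (L : ℝ) d k) ((L : ℝ) ^ k) (L ^ (d * k)) (Ht - Ht) with hΔt
  set g₁ := (1 + 8 * C87) * (C * A𝒫a * A⁻¹) with hg₁
  set ρ₁ := (1 + 8 * C87) * (C * ℓ * κp * A⁻¹) with hρ₁
  set gΦ := 256 * Real.exp (1 / 4) * ((A𝒫a + 4) * b ^ 2 + 2 * b * va + va ^ 2) with hgΦ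
  set ρΦ := (512 * Real.exp (1 / 4) * (b * vK) + 256 * Real.exp (1 / 4) * (vb + vK) * vK) +
      (8 * Real.exp (1 / 4) * b * ℓ * κp + 16 * Real.exp (3 / 8) * (δγ / h ^ 2 * b) +
        256 * Real.exp (1 / 4) * (2 * (δγ / h ^ 2 * b)) * vb) with hρΦ
  set 𝓧' := blockPartIndex D U with h𝓧'def
  -- sizes and basic facts
  have hd2 : 2 ≤ d := by omega
  have hpR : p ≤ R := by omega
  have hMord : d / 2 + 1 ≤ Mord := by omega
  have hr₀2 : 2 ≤ r₀ := by omega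
  have hL0 : (0 : ℝ) < L := by exact_mod_cast hLodd.pos
  have hL1 : 1 ≤ L := hLodd.pos
  have hA0 : 0 < A := by linarith
  have hk1 : k + 1 ≤ N + 1 := by omega
  have hk : k ≤ N := by omega
  have hMo : Odd M := by rw [hM]; exact hLodd.pow
  have hsodd : Odd (L ^ k) := hLodd.pow
  have h𝔥 : 0 < fieldWt h (L : ℝ) d k := fieldWt_pos hh hL0 d k
  have hRk : (0 : ℝ) < (L : ℝ) ^ k := by positivity
  have hnn : ∀ G : RelevantHamiltonian ℂ d, 0 ≤ hamNorm (fieldWt h (L : ℝ) d k) ((L : ℝ) ^ k) (L ^ (d * k)) G :=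
    fun G => hamNorm_nonneg h𝔥.le hRk.le _ _
  have hΔ0 : hamNorm (fieldWt h (L : ℝ) d k) ((L : ℝ) ^ k) (L ^ (d * k)) (Ht - Ht) = 0 := by
    rw [sub_self, hamNorm_zero]
  have hτ0 : 0 ≤ τ := (hnn Ht).trans hHt
  have hb0 : 0 ≤ b := (hnn H).trans hH
  have hC87_0 : 0 ≤ C87 := pi2BoundConst_nonneg d (by positivity)
  have hAinv : 0 ≤ A⁻¹ := inv_nonneg.2 hA0.le
  have hva0 : 0 ≤ va := by positivity
  have hvb0 : 0 ≤ vb := by positivity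
  have hvK0 : 0 ≤ vK := by positivity
  have hg₁0 : 0 ≤ g₁ := by positivity
  have hρ₁0 : 0 ≤ ρ₁ := by positivity
  have hgΦ0 : 0 ≤ gΦ := by positivity
  have hh20 : 0 ≤ δγ / h ^ 2 * b := by positivity
  have hρΦ0 : 0 ≤ ρΦ := by positivity
  have hΔt0 : 0 ≤ Δt := by have := hnn (Ht - Ht); positivity
  have hγa : ∀ q, ((L ^ (d * k) : ℕ) : ℝ) * |gradCov D.𝒞 q| ≤ h ^ 2 := fun q =>
    abs_gradCov_le_of_stepKernelBounds hS hh2a q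
  have hγb : ∀ q, ((L ^ (d * k) : ℕ) : ℝ) * |gradCov Db.𝒞 q| ≤ h ^ 2 := fun q =>
    abs_gradCov_le_of_stepKernelBounds hSb hh2b q
  -- the index set: single blocks inside `U`
  have h𝓧' : 𝓧' ⊆ (polys (L ^ k) univ).filter (fun X => reblock (L ^ k) (L * L ^ k) X = U) := by
    have h := filter_reblock_isConn_card_eq_one D hMo (by rw [hDs]; exact hsodd) (by rw [hDL]; exact hLodd) U
    rw [hDs, hDL] at h
    rw [h𝓧'def, ← h]
    exact filter_subset _ _
  have hblk : ∀ X ∈ 𝓧', ∃ y, X = blockOf (L ^ k) y := fun X hX => by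
    have h := blockPartIndex_subset_blocks D U hX
    rw [hDs] at h
    obtain ⟨y, -, rfl⟩ := mem_blocks.1 h
    exact ⟨y, rfl⟩
  have hXU : ∀ X ∈ 𝓧', X ⊆ U := fun X hX => by
    have h := blockPartIndex_subset_blocks D U hX
    rw [hDs] at h
    obtain ⟨y, hy, rfl⟩ := mem_blocks.1 h
    have hUk : IsPolymer (L ^ k) U := by
      have : IsPolymer (L * L ^ k) U := by rw [show L * L ^ k = L ^ (k + 1) by rw [pow_succ']]; exact hU
      exact this.of_mul hsodd hLodd
    exact hUk y hy
  have hcard𝓧' : (𝓧'.card : ℝ) ≤ (blocks (L ^ k) U).card := by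
    have h := blockPartIndex_subset_blocks D U
    rw [hDs] at h
    exact_mod_cast card_le_card h
  -- the extracted Hamiltonians `V_a = B_aK`, `V_b = B_bK`
  have hB₀b : Db.B₀ = blockOf (L ^ k) x₀ := hDbB.trans hB₀
  have hc₀b : Db.c₀ = boxCorner (L ^ k) (starRad R L d k) x₀ := hDbc.trans hc₀
  have hVale : hamNorm (fieldWt h (L : ℝ) d k) ((L : ℝ) ^ k) (L ^ (d * k)) (opB D K) ≤ va :=
    hamNorm_opB_abkm_le_scale_of_stepKernelBounds hLodd hL hM hkN hpR hr₀2 hB hh hA1 D hS hB₀ hc₀ hC hK hKd hKloc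
  have hVble : hamNorm (fieldWt h (L : ℝ) d k) ((L : ℝ) ^ k) (L ^ (d * k)) (opB Db K) ≤ vb :=
    hamNorm_opB_abkm_le_scale_of_stepKernelBounds hLodd hL hM hkN hpR hr₀2 hB hh hA1 Db hSb hB₀b hc₀b hC hK hKd hKloc
  have hVKle : hamNorm (fieldWt h (L : ℝ) d k) ((L : ℝ) ^ k) (L ^ (d * k)) (opB D K - opB Db K) ≤ vK :=
    hamNorm_opB_sub_abkm_le_scale_of_stepKernelBounds (p := p) hd hLodd hL hM hkN hpM hMR hr₀ hB hh hA1
      D Db hS hSb hB₀ hc₀ hDbB hDbc hdiff hC hK hKd hKloc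
  have hva64 : va ≤ 1 / 64 := hva
  have hvb64 : vb ≤ 1 / 64 := hvb
  have hH64 : hamNorm (fieldWt h (L : ℝ) d k) ((L : ℝ) ^ k) (L ^ (d * k)) H ≤ 1 / 64 := hH.trans hb
  have hH32 : hamNorm (fieldWt h (L : ℝ) d k) ((L : ℝ) ^ k) (L ^ (d * k)) H ≤ 1 / 32 := hH64.trans (by norm_num)
  have hH8 : hamNorm (fieldWt h (L : ℝ) d k) ((L : ℝ) ^ k) (L ^ (d * k)) H ≤ 1 / 8 := hH64.trans (by norm_num)
  have hVa64 : hamNorm (fieldWt h (L : ℝ) d k) ((L : ℝ) ^ k) (L ^ (d * k)) (opB D K) ≤ 1 / 64 := hVale.trans hva64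
  have hVb64 : hamNorm (fieldWt h (L : ℝ) d k) ((L : ℝ) ^ k) (L ^ (d * k)) (opB Db K) ≤ 1 / 64 := hVble.trans hvb64
  have hVa16 : hamNorm (fieldWt h (L : ℝ) d k) ((L : ℝ) ^ k) (L ^ (d * k)) (opB D K) ≤ 1 / 16 := hVa64.trans (by norm_num)
  -- (1) the `(p_B − 1)·blockTerm(B)` terms
  have h1 := tayNormLE_subsum_pMinusOne_sub_abkm_slot (n := n) (lam := lam) (μ := μ) (θbar := θbar) (p := p) (r₀ := r₀)
    (A := A) hd hLodd hL hR2
    hM hkN hp hMord hB hδ₀ hδ₁ hh hh0 hU h𝓧' hHt hHt hτ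
    (Gs := fun X φ => blockTerm D K X φ) (Gs' := fun X φ => blockTerm Db K X φ) (g := fun _ => g₁) (ρ := fun _ => ρ₁)
    (fun X hX X₁ hX₁ => by
      rw [mem_singleton.1 hX₁, sdiff_empty]
      obtain ⟨y, rfl⟩ := hblk X hX
      exact tayNormLE_blockTerm_abkm_of_stepKernelBounds hd2 hLodd hL hM hkN hp hpR hMord hr₀2 hB hδ₀ hδ₁ hh hh0 hA1 D hS
        hB₀ hc₀ y hC hK hKd hKloc)
    (fun X hX X₁ hX₁ => by
      rw [mem_singleton.1 hX₁, sdiff_empty]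
      obtain ⟨y, rfl⟩ := hblk X hX
      exact tayNormLE_blockTerm_kernelOnly_sub_abkm_of_stepKernelBounds hd hLodd hL hM hkN hp hpM hMR hr₀ hB hδ₀ hδ₁ hh
        hh0 hA1 D Db hS hSb hB₀ hc₀ hDbB hDbc hdiff y hC hK hKd hKloc)
    (fun X hX X₁ hX₁ => by
      rw [mem_singleton.1 hX₁, sdiff_empty]
      obtain ⟨y, rfl⟩ := hblk X hX
      exact contDiff_blockTerm_abkm_of_stepKernelBounds hB hLodd hM hA0 D hS y hC hK hKd hKloc)
    (fun X hX X₁ hX₁ => by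
      rw [mem_singleton.1 hX₁, sdiff_empty]
      obtain ⟨y, rfl⟩ := hblk X hX
      exact contDiff_blockTerm_abkm_of_stepKernelBounds hB hLodd hM hA0 Db hSb y hC hK hKd hKloc)
    (fun X hX X₁ hX₁ => by
      rw [mem_singleton.1 hX₁, sdiff_empty]
      obtain ⟨y, rfl⟩ := hblk X hX
      exact isGaugeLocal_blockTerm_abkm hLodd hh hp k D y
        (hKloc _ (isPolymer_blockOf _ y) (TorusPolymer.isConn_blockOf hMo hsodd y)))
    (fun X hX X₁ hX₁ => by
      rw [mem_singleton.1 hX₁, sdiff_empty]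
      obtain ⟨y, rfl⟩ := hblk X hX
      exact isGaugeLocal_blockTerm_abkm hLodd hh hp k Db y
        (hKloc _ (isPolymer_blockOf _ y) (TorusPolymer.isConn_blockOf hMo hsodd y)))
    (fun _ _ _ _ => hg₁0) (fun _ _ _ _ => hρ₁0)
  -- (2) the `p_B·Φ_B` terms
  have h𝓨 : ∀ X ∈ 𝓧', ({∅} : Finset (Finset (Fin d → ZMod M))) ⊆ polys (L ^ k) X := fun X _ => by
    intro X₁ hX₁; rw [mem_singleton.1 hX₁]; exact empty_mem_polys _ _
  have h2 := tayNormLE_subsum_reblockTerm_sub_abkm_slot (n := n) (lam := lam) (μ := μ) (θbar := θbar) (p := p) (r₀ := r₀)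
    (A := A) hd hLodd hL hR2
    hM hkN hp hMord hB hδ₀ hδ₁ hh hh0 hU h𝓧' (𝓨 := fun _ => ({∅} : Finset (Finset (Fin d → ZMod M)))) h𝓨
    hHt hHt hτ
    (Gs := fun X φ => fluctDefect D.𝒞 H X φ +
        (expNegH (stepOpA (gradCov D.𝒞) H) X φ - 1) * (1 - Complex.exp (-(eval (opB D K) X φ))) -
        (Complex.exp (-(eval (opB D K) X φ)) - 1 + eval (opB D K) X φ))
    (Gs' := fun X φ => fluctDefect Db.𝒞 H X φ +
        (expNegH (stepOpA (gradCov Db.𝒞) H) X φ - 1) * (1 - Complex.exp (-(eval (opB Db K) X φ))) -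
        (Complex.exp (-(eval (opB Db K) X φ)) - 1 + eval (opB Db K) X φ))
    (g := fun _ => gΦ) (ρ := fun _ => ρΦ)
    (fun X hX X₁ hX₁ => by
      rw [mem_singleton.1 hX₁, sdiff_empty]
      obtain ⟨y, rfl⟩ := hblk X hX
      refine (tayNormLE_blockBracket_abkm_of_stepKernelBounds (p := p) (r₀ := r₀) (A := A) hd2 hB hLodd hM hk hS hδ₀ hδ₁ hh hh0
        hMord hp hγa y (H := H) (V := opB D K) hH32 hVa16).mono ?_
        (fun φ => (W.midWeight_pos k _ φ).le)
      rw [hgΦ]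
      have e1 : hamNorm (fieldWt h (L : ℝ) d k) ((L : ℝ) ^ k) (L ^ (d * k)) H ^ 2 ≤ b ^ 2 :=
        pow_le_pow_left₀ (hnn H) hH 2
      have e2 : hamNorm (fieldWt h (L : ℝ) d k) ((L : ℝ) ^ k) (L ^ (d * k)) (opB D K) ^ 2 ≤ va ^ 2 :=
        pow_le_pow_left₀ (hnn _) hVale 2
      have e3 : hamNorm (fieldWt h (L : ℝ) d k) ((L : ℝ) ^ k) (L ^ (d * k)) H *
          hamNorm (fieldWt h (L : ℝ) d k) ((L : ℝ) ^ k) (L ^ (d * k)) (opB D K) ≤ b * va :=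
        mul_le_mul hH hVale (hnn _) hb0
      have hA4 : 0 ≤ A𝒫a + 4 := by positivity
      refine mul_le_mul_of_nonneg_left ?_ (by positivity)
      have e1' := mul_le_mul_of_nonneg_left e1 hA4
      have e3' := mul_le_mul_of_nonneg_left e3 (show (0 : ℝ) ≤ 2 by norm_num)
      linarith [e1', e2, e3'])
    (fun X hX X₁ hX₁ => by
      rw [mem_singleton.1 hX₁, sdiff_empty]
      obtain ⟨y, rfl⟩ := hblk X hX
      -- `Φ(𝒞a,H,V_a) − Φ(𝒞b,H,V_b) = [Φ(𝒞a,H,V_a) − Φ(𝒞a,H,V_b)] + [Φ(𝒞a,H,V_b) − Φ(𝒞b,H,V_b)]`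
      have hV := tayNormLE_blockBracket_sub_abkm_of_stepKernelBounds (p := p) (r₀ := r₀) (A := A) hd2 hB hA𝒫a hLodd hM hk hS
        hδ₀ hδ₁ hh hh0 hMord hp hγa y (H := H) (H' := H) (V := opB D K) (V' := opB Db K) hH64 hH64 hVa64 hVb64
      have hKer := tayNormLE_blockBracket_kernelOnly_sub_abkm_of_stepKernelBounds (p := p) (r₀ := r₀) (A := A) hd2 hB
        hLodd hM hk hS hSb hδ₀ hδ₁ hh hh0 hMord hp hγa hγb hδγ hγab hdiff y (H := H) (V := opB Db K) hH64 hVb64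
      have hVd := (contDiff_blockBracket_abkm_of_stepKernelBounds (p := p) (r₀ := r₀) (A := A) hd2 hB hLodd hM hk hS hδ₀ hδ₁
        hh hh0 hMord hp y (opB D K) hH8).sub (contDiff_blockBracket_abkm_of_stepKernelBounds (p := p) (r₀ := r₀) (A := A)
        hd2 hB hLodd hM hk hS hδ₀ hδ₁ hh hh0 hMord hp y (opB Db K) hH8)
      have hKerd := (contDiff_blockBracket_abkm_of_stepKernelBounds (p := p) (r₀ := r₀) (A := A) hd2 hB hLodd hM hk hS hδ₀
        hδ₁ hh hh0 hMord hp y (opB Db K) hH8).sub (contDiff_blockBracket_abkm_of_stepKernelBounds (p := p) (r₀ := r₀)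
        (A := A) hd2 hB hLodd hM hk hSb hδ₀ hδ₁ hh hh0 hMord hp y (opB Db K) hH8)
      have hsum := hV.add hKer hVd hKerd
      have heq : (fun φ => (fluctDefect D.𝒞 H (blockOf (L ^ k) y) φ +
            (expNegH (stepOpA (gradCov D.𝒞) H) (blockOf (L ^ k) y) φ - 1) *
              (1 - Complex.exp (-(eval (opB D K) (blockOf (L ^ k) y) φ))) -
            (Complex.exp (-(eval (opB D K) (blockOf (L ^ k) y) φ)) - 1 + eval (opB D K) (blockOf (L ^ k) y) φ)) -
          (fluctDefect Db.𝒞 H (blockOf (L ^ k) y) φ +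
            (expNegH (stepOpA (gradCov Db.𝒞) H) (blockOf (L ^ k) y) φ - 1) *
              (1 - Complex.exp (-(eval (opB Db K) (blockOf (L ^ k) y) φ))) -
            (Complex.exp (-(eval (opB Db K) (blockOf (L ^ k) y) φ)) - 1 + eval (opB Db K) (blockOf (L ^ k) y) φ))) =
          (fun φ => (fluctDefect D.𝒞 H (blockOf (L ^ k) y) φ +
            (expNegH (stepOpA (gradCov D.𝒞) H) (blockOf (L ^ k) y) φ - 1) *
              (1 - Complex.exp (-(eval (opB D K) (blockOf (L ^ k) y) φ))) -
            (Complex.exp (-(eval (opB D K) (blockOf (L ^ k) y) φ)) - 1 + eval (opB D K) (blockOf (L ^ k) y) φ)) -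
          (fluctDefect D.𝒞 H (blockOf (L ^ k) y) φ +
            (expNegH (stepOpA (gradCov D.𝒞) H) (blockOf (L ^ k) y) φ - 1) *
              (1 - Complex.exp (-(eval (opB Db K) (blockOf (L ^ k) y) φ))) -
            (Complex.exp (-(eval (opB Db K) (blockOf (L ^ k) y) φ)) - 1 + eval (opB Db K) (blockOf (L ^ k) y) φ))) +
          (fun φ => (fluctDefect D.𝒞 H (blockOf (L ^ k) y) φ +
            (expNegH (stepOpA (gradCov D.𝒞) H) (blockOf (L ^ k) y) φ - 1) *
              (1 - Complex.exp (-(eval (opB Db K) (blockOf (L ^ k) y) φ))) -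
            (Complex.exp (-(eval (opB Db K) (blockOf (L ^ k) y) φ)) - 1 + eval (opB Db K) (blockOf (L ^ k) y) φ)) -
          (fluctDefect Db.𝒞 H (blockOf (L ^ k) y) φ +
            (expNegH (stepOpA (gradCov Db.𝒞) H) (blockOf (L ^ k) y) φ - 1) *
              (1 - Complex.exp (-(eval (opB Db K) (blockOf (L ^ k) y) φ))) -
            (Complex.exp (-(eval (opB Db K) (blockOf (L ^ k) y) φ)) - 1 + eval (opB Db K) (blockOf (L ^ k) y) φ))) := by
        funext φ; simp only [Pi.add_apply]; ring
      rw [heq]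
      refine hsum.mono ?_ (fun φ => (W.midWeight_pos k _ φ).le)
      rw [hρΦ]
      have he : 0 ≤ 256 * Real.exp (1 / 4) := by positivity
      have he' : 0 ≤ 512 * Real.exp (1 / 4) := by positivity
      have hnHH : hamNorm (fieldWt h (L : ℝ) d k) ((L : ℝ) ^ k) (L ^ (d * k)) (H - H) = 0 := by
        rw [sub_self, hamNorm_zero]
      rw [hnHH]
      have e3 : hamNorm (fieldWt h (L : ℝ) d k) ((L : ℝ) ^ k) (L ^ (d * k)) H *
            hamNorm (fieldWt h (L : ℝ) d k) ((L : ℝ) ^ k) (L ^ (d * k)) (opB D K - opB Db K) ≤ b * vK :=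
        mul_le_mul hH hVKle (hnn _) hb0
      have e4 : (hamNorm (fieldWt h (L : ℝ) d k) ((L : ℝ) ^ k) (L ^ (d * k)) (opB Db K) +
            hamNorm (fieldWt h (L : ℝ) d k) ((L : ℝ) ^ k) (L ^ (d * k)) (opB D K - opB Db K)) *
          hamNorm (fieldWt h (L : ℝ) d k) ((L : ℝ) ^ k) (L ^ (d * k)) (opB D K - opB Db K) ≤ (vb + vK) * vK :=
        mul_le_mul (add_le_add hVble hVKle) hVKle (hnn _) (by positivity)
      have e5 : 8 * Real.exp (1 / 4) * hamNorm (fieldWt h (L : ℝ) d k) ((L : ℝ) ^ k) (L ^ (d * k)) H * ℓ * κp ≤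
          8 * Real.exp (1 / 4) * b * ℓ * κp := by
        have := mul_le_mul_of_nonneg_right (mul_le_mul_of_nonneg_right hH hℓ) hκp
        nlinarith [Real.exp_pos (1 / 4 : ℝ)]
      have e6 : δγ / h ^ 2 * hamNorm (fieldWt h (L : ℝ) d k) ((L : ℝ) ^ k) (L ^ (d * k)) H ≤ δγ / h ^ 2 * b :=
        mul_le_mul_of_nonneg_left hH (by positivity)
      have e7 : 2 * (δγ / h ^ 2 * hamNorm (fieldWt h (L : ℝ) d k) ((L : ℝ) ^ k) (L ^ (d * k)) H) *
            hamNorm (fieldWt h (L : ℝ) d k) ((L : ℝ) ^ k) (L ^ (d * k)) (opB Db K) ≤ 2 * (δγ / h ^ 2 * b) * vb :=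
        mul_le_mul (by linarith) hVble (hnn _) (by positivity)
      have f3 := mul_le_mul_of_nonneg_left e3 he'
      have f4 := mul_le_mul_of_nonneg_left e4 he
      have f6 := mul_le_mul_of_nonneg_left e6 (show (0 : ℝ) ≤ 16 * Real.exp (3 / 8) by positivity)
      have f7 := mul_le_mul_of_nonneg_left e7 he
      have hA4 : 0 ≤ A𝒫a + 4 := by positivity
      have z1 : 512 * Real.exp (1 / 4) * (A𝒫a + 4) *
          (hamNorm (fieldWt h (L : ℝ) d k) ((L : ℝ) ^ k) (L ^ (d * k)) H +
            hamNorm (fieldWt h (L : ℝ) d k) ((L : ℝ) ^ k) (L ^ (d * k)) H) * 0 = 0 := by ring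
      have z2 : (0 : ℝ) * hamNorm (fieldWt h (L : ℝ) d k) ((L : ℝ) ^ k) (L ^ (d * k)) (opB D K) = 0 := by ring
      rw [z1, z2, zero_add, zero_add]
      linarith [f3, f4, f6, f7, e5])
    (fun X hX X₁ hX₁ => by
      rw [mem_singleton.1 hX₁, sdiff_empty]
      obtain ⟨y, rfl⟩ := hblk X hX
      exact contDiff_blockBracket_abkm_of_stepKernelBounds (p := p) (r₀ := r₀) (A := A) hd2 hB hLodd hM hk hS hδ₀ hδ₁ hh hh0 hMord
        hp y (opB D K) hH8)
    (fun X hX X₁ hX₁ => by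
      rw [mem_singleton.1 hX₁, sdiff_empty]
      obtain ⟨y, rfl⟩ := hblk X hX
      exact contDiff_blockBracket_abkm_of_stepKernelBounds (p := p) (r₀ := r₀) (A := A) hd2 hB hLodd hM hk hSb hδ₀ hδ₁ hh hh0
        hMord hp y (opB Db K) hH8)
    (fun X hX X₁ hX₁ => by
      rw [mem_singleton.1 hX₁, sdiff_empty]
      obtain ⟨y, rfl⟩ := hblk X hX
      exact isGaugeLocal_blockBracket_abkm_of_stepKernelBounds hLodd hh hp k y H (opB D K))
    (fun X hX X₁ hX₁ => by
      rw [mem_singleton.1 hX₁, sdiff_empty]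
      obtain ⟨y, rfl⟩ := hblk X hX
      exact isGaugeLocal_blockBracket_abkm_of_stepKernelBounds hLodd hh hp k y H (opB Db K))
    (fun _ _ _ _ => hgΦ0) (fun _ _ _ _ => hρΦ0)
  -- smoothness of the two summed functionals
  have hcdE : ∀ (H₀ : RelevantHamiltonian ℂ d) (Z : Finset (Fin d → ZMod M)),
      ContDiff ℝ r₀ (fun φ : (Fin d → ZMod M) → ℝ => bprod (L ^ k) (fun B => expNegH H₀ B φ) Z) := by
    intro H₀ Z
    unfold TorusPolymer.bprod
    exact contDiff_prod fun B _ => (contDiff_eval H₀ B (n := r₀)).neg.cexp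
  have hcd3 : ∀ (H₀ : RelevantHamiltonian ℂ d) (Z : Finset (Fin d → ZMod M)),
      ContDiff ℝ r₀ (fun φ : (Fin d → ZMod M) → ℝ => bprod (L ^ k) (fun B => 1 - expNegH H₀ B φ) Z) := by
    intro H₀ Z
    unfold TorusPolymer.bprod
    exact contDiff_prod fun B _ => contDiff_const.sub (contDiff_eval H₀ B (n := r₀)).neg.cexp
  have hGd : ∀ X ∈ 𝓧', ContDiff ℝ r₀ (blockTerm D K X) ∧ ContDiff ℝ r₀ (blockTerm Db K X) := fun X hX => by
    obtain ⟨y, rfl⟩ := hblk X hX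
    exact ⟨contDiff_blockTerm_abkm_of_stepKernelBounds hB hLodd hM hA0 D hS y hC hK hKd hKloc,
      contDiff_blockTerm_abkm_of_stepKernelBounds hB hLodd hM hA0 Db hSb y hC hK hKd hKloc⟩
  have hΦd : ∀ X ∈ 𝓧', ∀ (Dq : StepData d M) {A𝒫q C₂q : ℝ},
      StepKernelBounds (abkmWeightData L N Mord R θbar (schedDelta δ₀ δ₁ N) 𝒞) L k A𝒫q C₂q Dq.𝒞 →
      ContDiff ℝ r₀ (fun φ => fluctDefect Dq.𝒞 H X φ +
        (expNegH (stepOpA (gradCov Dq.𝒞) H) X φ - 1) * (1 - Complex.exp (-(eval (opB Dq K) X φ))) -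
        (Complex.exp (-(eval (opB Dq K) X φ)) - 1 + eval (opB Dq K) X φ)) := fun X hX Dq A𝒫q C₂q hSq => by
    obtain ⟨y, rfl⟩ := hblk X hX
    exact contDiff_blockBracket_abkm_of_stepKernelBounds (p := p) (r₀ := r₀) (A := A) hd2 hB hLodd hM hk hSq hδ₀ hδ₁ hh hh0
      hMord hp y (opB Dq K) hH8
  have hcd1 : ContDiff ℝ r₀ (fun φ : (Fin d → ZMod M) → ℝ => ∑ X ∈ 𝓧',
      ((bprod (L ^ k) (fun B => expNegH Ht B φ) (U \ X) * bprod (L ^ k) (fun B => expNegH (-Ht) B φ) (X \ U) - 1) *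
          blockTerm D K X φ -
        (bprod (L ^ k) (fun B => expNegH Ht B φ) (U \ X) * bprod (L ^ k) (fun B => expNegH (-Ht) B φ) (X \ U) - 1) *
          blockTerm Db K X φ)) := by
    refine ContDiff.sum fun X hX => ?_
    exact ((((hcdE Ht (U \ X)).mul (hcdE (-Ht) (X \ U))).sub contDiff_const).mul (hGd X hX).1).sub
      ((((hcdE Ht (U \ X)).mul (hcdE (-Ht) (X \ U))).sub contDiff_const).mul (hGd X hX).2)
  have hcd2 : ContDiff ℝ r₀ (fun φ : (Fin d → ZMod M) → ℝ => ∑ X ∈ 𝓧',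
      ∑ X₁ ∈ ({∅} : Finset (Finset (Fin d → ZMod M))),
        (bprod (L ^ k) (fun B => expNegH Ht B φ) (U \ X) * bprod (L ^ k) (fun B => expNegH (-Ht) B φ) (X \ U) *
            (bprod (L ^ k) (fun B => 1 - expNegH Ht B φ) X₁ *
              (fluctDefect D.𝒞 H (X \ X₁) φ +
                (expNegH (stepOpA (gradCov D.𝒞) H) (X \ X₁) φ - 1) *
                  (1 - Complex.exp (-(eval (opB D K) (X \ X₁) φ))) -
                (Complex.exp (-(eval (opB D K) (X \ X₁) φ)) - 1 + eval (opB D K) (X \ X₁) φ))) -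
          bprod (L ^ k) (fun B => expNegH Ht B φ) (U \ X) * bprod (L ^ k) (fun B => expNegH (-Ht) B φ) (X \ U) *
            (bprod (L ^ k) (fun B => 1 - expNegH Ht B φ) X₁ *
              (fluctDefect Db.𝒞 H (X \ X₁) φ +
                (expNegH (stepOpA (gradCov Db.𝒞) H) (X \ X₁) φ - 1) *
                  (1 - Complex.exp (-(eval (opB Db K) (X \ X₁) φ))) -
                (Complex.exp (-(eval (opB Db K) (X \ X₁) φ)) - 1 + eval (opB Db K) (X \ X₁) φ))))) := by
    refine ContDiff.sum fun X hX => ContDiff.sum fun X₁ hX₁ => ?_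
    have e := mem_singleton.1 hX₁
    subst e
    simp only [sdiff_empty]
    exact (((hcdE Ht (U \ X)).mul (hcdE (-Ht) (X \ U))).mul ((hcd3 Ht ∅).mul
      (hΦd X hX D hS))).sub
      (((hcdE Ht (U \ X)).mul (hcdE (-Ht) (X \ U))).mul ((hcd3 Ht ∅).mul (hΦd X hX Db hSb)))
  have hsum := h1.add h2 hcd1 hcd2
  -- the `rest(B)` terms vanish on blocks
  have hrest : ∀ X ∈ 𝓧', ∀ (𝒞q : (Fin d → ZMod M) → ℝ) (φ : (Fin d → ZMod M) → ℝ),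
      fluct 𝒞q (fun ψ => ∑ Y ∈ ((polys (L ^ k) X).erase X).erase ∅,
        bprod (L ^ k) (fun B' => expNegH H B' ψ - 1) (X \ Y) * K Y ψ) φ = 0 := by
    intro X hX 𝒞q φ
    obtain ⟨y, rfl⟩ := hblk X hX
    have hf : (fun ψ : (Fin d → ZMod M) → ℝ => ∑ Y ∈ ((polys (L ^ k) (blockOf (L ^ k) y)).erase (blockOf (L ^ k) y)).erase ∅,
        bprod (L ^ k) (fun B' => expNegH H B' ψ - 1) (blockOf (L ^ k) y \ Y) * K Y ψ) = fun _ => (0 : ℂ) := by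
      funext ψ; exact sum_rest_blockOf_eq_zero _ _ _
    rw [hf, fluct_const]
  -- identify the function and bound the constant
  intro φ
  have key := hsum φ
  refine le_trans (le_of_eq_of_le ?_ key) (mul_le_mul_of_nonneg_right ?_ (W.weight_pos (k + 1) U φ).le)
  · -- the function
    congr 1
    funext ψ
    simp only [Pi.add_apply]
    rw [← sum_sub_distrib, ← sum_add_distrib]
    refine sum_congr rfl fun X hX => ?_
    rw [sum_singleton, hrest X hX D.𝒞 ψ, hrest X hX Db.𝒞 ψ]
    simp only [sdiff_empty, bprod_empty, mul_zero, add_zero, one_mul]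
    ring
  · -- the constant: every summand `(X, ∅)` is at most `κ^{|U|_k}(δ g + ρ)`
    clear key hsum hcd1 hcd2 h1 h2
    have ha0 : 0 ≤ Real.exp (1 / 4) := (Real.exp_pos _).le
    have h16τ : 0 ≤ 16 * Real.exp (3 / 8) * τ := by positivity
    have hκ1 : 1 ≤ κ := by linarith [hκ', Real.exp_pos (1 / 4)]
    have hm : ∀ X ∈ 𝓧', (blocks (L ^ k) (U \ X)).card ≤ (blocks (L ^ k) U).card := fun X _ =>
      card_le_card (blocks_mono _ sdiff_subset)
    have hS : ∀ X ∈ 𝓧', ∀ X₁ ∈ ({∅} : Finset (Finset (Fin d → ZMod M))), ∀ (δ g ρ : ℝ), 0 ≤ δ → 0 ≤ g → 0 ≤ ρ →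
        1 + Real.exp (1 / 4) + δ ≤ κ →
        (((∏ _B ∈ blocks (L ^ k) (U \ X), (Real.exp (1 / 4) + δ)) - ∏ _B ∈ blocks (L ^ k) (U \ X), Real.exp (1 / 4)) *
            (∏ _B ∈ blocks (L ^ k) (X \ U), Real.exp (1 / 4)) *
            ((∏ _B ∈ blocks (L ^ k) X₁, 8 * Real.exp (1 / 4) * τ) * g) +
          (∏ _B ∈ blocks (L ^ k) (U \ X), Real.exp (1 / 4)) *
            ((∏ _B ∈ blocks (L ^ k) (X \ U), (Real.exp (1 / 4) + δ)) - ∏ _B ∈ blocks (L ^ k) (X \ U), Real.exp (1 / 4)) *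
            ((∏ _B ∈ blocks (L ^ k) X₁, 8 * Real.exp (1 / 4) * τ) * g) +
          (∏ _B ∈ blocks (L ^ k) (U \ X), Real.exp (1 / 4)) * (∏ _B ∈ blocks (L ^ k) (X \ U), Real.exp (1 / 4)) *
            (((∏ _B ∈ blocks (L ^ k) X₁, (8 * Real.exp (1 / 4) * τ + δ)) -
              ∏ _B ∈ blocks (L ^ k) X₁, 8 * Real.exp (1 / 4) * τ) * g) +
          (∏ _B ∈ blocks (L ^ k) (U \ X), Real.exp (1 / 4)) * (∏ _B ∈ blocks (L ^ k) (X \ U), Real.exp (1 / 4)) *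
            ((∏ _B ∈ blocks (L ^ k) X₁, 8 * Real.exp (1 / 4) * τ) * ρ)) ≤
          κ ^ (blocks (L ^ k) U).card * (δ * g + ρ) := by
      intro X hX X₁ hX₁ δ g ρ hδ hg hρ hκδ
      have e1 := mem_singleton.1 hX₁
      subst e1
      have hXU0 : X \ U = ∅ := sdiff_eq_empty_iff_subset.2 (hXU X hX)
      rw [hXU0]
      simp only [blocks_empty, prod_empty]
      have hn := hm X hX
      have hκa : Real.exp (1 / 4) ≤ κ := by linarith
      have he : (∏ _B ∈ blocks (L ^ k) (U \ X), (Real.exp (1 / 4) + δ)) - ∏ _B ∈ blocks (L ^ k) (U \ X), Real.exp (1 / 4) ≤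
          δ * κ ^ (blocks (L ^ k) U).card := by
        rw [prod_const, prod_const]
        refine (add_pow_sub_pow_le ha0 hδ _).trans (mul_le_mul_of_nonneg_left ?_ hδ)
        exact (pow_le_pow_left₀ (by positivity) hκδ _).trans (pow_le_pow_right₀ hκ1 hn)
      have ha : ∏ _B ∈ blocks (L ^ k) (U \ X), Real.exp (1 / 4) ≤ κ ^ (blocks (L ^ k) U).card := by
        rw [prod_const]
        exact (pow_le_pow_left₀ ha0 hκa _).trans (pow_le_pow_right₀ hκ1 hn)
      have key : ((∏ _B ∈ blocks (L ^ k) (U \ X), (Real.exp (1 / 4) + δ)) - ∏ _B ∈ blocks (L ^ k) (U \ X), Real.exp (1 / 4)) * g +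
          (∏ _B ∈ blocks (L ^ k) (U \ X), Real.exp (1 / 4)) * ρ ≤ κ ^ (blocks (L ^ k) U).card * (δ * g + ρ) := by
        calc _ ≤ δ * κ ^ (blocks (L ^ k) U).card * g + κ ^ (blocks (L ^ k) U).card * ρ :=
              add_le_add (mul_le_mul_of_nonneg_right he hg) (mul_le_mul_of_nonneg_right ha hρ)
          _ = κ ^ (blocks (L ^ k) U).card * (δ * g + ρ) := by ring
      linarith [key]
    -- the two `δ`'s: `16e^{3/8}‖H̃ − H̃‖ = 0` and `16e^{3/8}‖H̃ − 0‖ ≤ 16e^{3/8}τ`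
    have hΔ₀ : 16 * Real.exp (3 / 8) * hamNorm (fieldWt h (L : ℝ) d k) ((L : ℝ) ^ k) (L ^ (d * k)) (Ht - 0) ≤
        16 * Real.exp (3 / 8) * τ := by
      rw [sub_zero]; exact mul_le_mul_of_nonneg_left hHt (by positivity)
    have hΔ₀0 : 0 ≤ 16 * Real.exp (3 / 8) * hamNorm (fieldWt h (L : ℝ) d k) ((L : ℝ) ^ k) (L ^ (d * k)) (Ht - 0) := by
      have := hnn (Ht - 0); positivity
    have hκΔ₀ : 1 + Real.exp (1 / 4) +
        16 * Real.exp (3 / 8) * hamNorm (fieldWt h (L : ℝ) d k) ((L : ℝ) ^ k) (L ^ (d * k)) (Ht - 0) ≤ κ := by linarith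
    have hκΔt : 1 + Real.exp (1 / 4) + Δt ≤ κ := by
      rw [hΔt, hΔ0, mul_zero, add_zero]; linarith [hκ', h16τ]
    have hκm : 0 ≤ κ ^ (blocks (L ^ k) U).card := by positivity
    -- sum over the blocks
    have hb1 := sum_le_sum fun X hX => sum_le_sum fun X₁ hX₁ => hS X hX X₁ hX₁ _ g₁ 0 hΔt0 hg₁0 le_rfl hκΔt
    have hb2 := sum_le_sum fun X hX => sum_le_sum fun X₁ hX₁ => hS X hX X₁ hX₁ _ ρ₁ 0 hΔ₀0 hρ₁0 le_rfl hκΔ₀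
    have hb3 := sum_le_sum fun X hX => sum_le_sum fun X₁ hX₁ => hS X hX X₁ hX₁ _ gΦ ρΦ hΔt0 hgΦ0 hρΦ0 hκΔt
    refine (add_le_add (add_le_add hb1 hb2) hb3).trans ?_
    simp only [sum_singleton]
    simp only [sum_const, nsmul_eq_mul]
    have hc0 : (0 : ℝ) ≤ 𝓧'.card := Nat.cast_nonneg _
    have hΔt00 : Δt = 0 := by rw [hΔt, hΔ0, mul_zero]
    rw [hΔt00]
    have e2 : 16 * Real.exp (3 / 8) * hamNorm (fieldWt h (L : ℝ) d k) ((L : ℝ) ^ k) (L ^ (d * k)) (Ht - 0) * ρ₁ + 0 ≤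
        16 * Real.exp (3 / 8) * τ * ρ₁ := by
      rw [add_zero]; exact mul_le_mul_of_nonneg_right hΔ₀ hρ₁0
    have e3 : (𝓧'.card : ℝ) * (κ ^ (blocks (L ^ k) U).card *
        (16 * Real.exp (3 / 8) * hamNorm (fieldWt h (L : ℝ) d k) ((L : ℝ) ^ k) (L ^ (d * k)) (Ht - 0) * ρ₁ + 0)) ≤
        (𝓧'.card : ℝ) * (κ ^ (blocks (L ^ k) U).card * (16 * Real.exp (3 / 8) * τ * ρ₁)) :=
      mul_le_mul_of_nonneg_left (mul_le_mul_of_nonneg_left e2 hκm) hc0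
    have hin0 : 0 ≤ 16 * Real.exp (3 / 8) * τ * ρ₁ + ρΦ := by positivity
    have e4 : (𝓧'.card : ℝ) * (κ ^ (blocks (L ^ k) U).card * (16 * Real.exp (3 / 8) * τ * ρ₁ + ρΦ)) ≤
        ((blocks (L ^ k) U).card : ℝ) * (κ ^ (blocks (L ^ k) U).card * (16 * Real.exp (3 / 8) * τ * ρ₁ + ρΦ)) :=
      mul_le_mul_of_nonneg_right hcard𝓧' (mul_nonneg hκm hin0)
    have lhs_eq : (𝓧'.card : ℝ) * (κ ^ (blocks (L ^ k) U).card * (0 * g₁ + 0)) +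
        (𝓧'.card : ℝ) * (κ ^ (blocks (L ^ k) U).card * (16 * Real.exp (3 / 8) * τ * ρ₁)) +
        (𝓧'.card : ℝ) * (κ ^ (blocks (L ^ k) U).card * (0 * gΦ + ρΦ)) =
        (𝓧'.card : ℝ) * (κ ^ (blocks (L ^ k) U).card * (16 * Real.exp (3 / 8) * τ * ρ₁ + ρΦ)) := by ring
    refine (add_le_add (add_le_add le_rfl e3) le_rfl).trans ?_
    rw [lhs_eq]
    refine e4.trans (le_of_eq ?_)
    rw [hρ₁, hρΦ, hvbdef, hvKdef, hC87]
    ring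

end Literature.MathematicalPhysics.StatisticalMechanics.GradientRG

end
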